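import Literature.Probability.Percolation.SlabRSWTheorem314Closer
import Literature.Probability.Percolation.SlabRSWLemma315
import Literature.Probability.Percolation.SlabRSWLadder
import HarnessLib

/-!
# Newman–Tassion–Wu 2017, Theorem 3.14 — the three-case assembly, with the Case-2 and Case-3
# inputs (GL with `S ⊊ R`; the exploration step with Lemma 3.16) as hypotheses on an abstract event `𝓑₂`

Topic: `Literature/Probability/Percolation`. The proof of NTW's RSW Theorem 3.14 (arXiv:1512.09107
pp. 16–17) runs: (3.38) ⇒ Lemma 3.15 (`P[𝒜] ≥ c₄`) ⇒ `c₄ ≤ P[𝓑₁] + P[𝓑₂] + P[𝒜 ∩ 𝓑₁ᶜ ∩ 𝓑₂ᶜ]` ⇒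
Case 1 (`P[𝓑₁] ≥ c₄/3`: the ladder), Case 2 (`P[𝓑₂] ≥ c₄/3`: the gluing lemma GL, Thm. 3.7, gives
`P[𝓑₁] ≥ h₀(c₄/3)`, then Case 1), Case 3 (the exploration of `X` and of `𝒩(Γ̄,3r)` plus Lemma 3.16 give
`f(14n,13n) ≥ c₇`) ⇒ `f(28n,14n) ≥ c₉` or `f(26n,13n) ≥ …` ⇒ `inf_m f(2m,m) > 0`.  Everything except
the two gluing inputs of Cases 2–3 is in the tree (`lemma315`, `case1_of_B1`, `hardWay_of_f2L_L`,
`real_lr_item1_iter`); this file assembles the theorem with those two inputs as HYPOTHESES about an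
ARBITRARY family of events `𝓑₂ n` (in NTW, `𝓑₂ = {Y ⟷^R 𝒩(Γ̄,3r)}`, `Γ = Γ_min^S(X, L(S))`):

* `(H2)` for every `x > 0` there are `y > 0` and `n₂` with `x ≤ P[𝓑₂ n] → y ≤ P[𝓑₁ n]` for `n ≥ n₂`
  (NTW (3.45): GL, Theorem 3.7 with `S ⊊ R`);
* `(H3)` for every `x > 0` there are `y > 0` and `n₃` with `x ≤ P[𝒜 n ∩ (𝓑₁ n)ᶜ ∩ (𝓑₂ n)ᶜ] →
  y ≤ f(14n, 13n)` for `n ≥ n₃` (NTW (3.47)–(3.52): the exploration/decoupling step and Lemma 3.16).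

Here `𝓑₁ n = {Y ⟷^R X}`, `𝒜 n = {L(S) ⟷^S X} ∩ {B(R) ⟷^R Y}` with `S = [0,7n]×[0,8n-1]`,
`X = {7n}×[0,4n-1]`, `R = [-7n,7n]×[0,13n-1]`, `Y = {7n}×[5n,13n-1]` (`SlabRSWLemma315.lean`).

* `real_lr_two_one_ge_of_f2L` — per-scale form of the closing step: `x ≤ f(2Ln,Ln)` ⇒
  `φ(x) ≤ f(2m,m)` for `Ln ≤ m`, `2m ≤ 3Ln`;
* **`thm314_of_cases`** — (3.38) ∧ (H2) ∧ (H3) ⇒ `∃ c' > 0, ∀ m ≥ 1, c' ≤ f_p(2m, m)`.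

## Sources

* C. M. Newman, V. Tassion, W. Wu, *Critical percolation and the minimal spanning tree in slabs*,
  Comm. Pure Appl. Math. 70 (2017) 2084–2120, arXiv:1512.09107: §3.5, Theorem 3.14 and its proof
  ((3.39)–(3.54)) [NewmanTassionWu2017].
-/

noncomputable section

namespace Literature.Probability.Percolation

open MeasureTheory LatticeModels SimpleGraph

namespace NTW17

variable {k : ℕ}

/-- **Per-scale closing step**: if `x ≤ f_p(2Ln, Ln)` (`0 ≤ x`, `Ln > 8ρ+16`), then
`((1-√(1-x))x)²/(K₁²K₂) ≤ f_p(2m, m)` for every `m` with `Ln ≤ m` and `2m ≤ 3Ln`.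
[cite: NewmanTassionWu2017, §3.5 (end of the proof of Theorem 3.14, "another use of Proposition 3.9")] -/
theorem real_lr_two_one_ge_of_f2L (hk : 1 ≤ k) {ρ : ℕ} (hρ : 4 ≤ ρ) (p : unitInterval) (hp0 : 0 < (p : ℝ))
    (hp1 : (p : ℝ) < 1) {L n : ℕ} (hLn : 8 * ρ + 16 < L * n) {x : ℝ} (hx0 : 0 ≤ x)
    (hx : x ≤ (bondPercolation (slabGraph 3 k) p).real
      (slabConn k (boxR 0 (2 * ((L : ℤ) * n)) 0 ((L : ℤ) * n)) {z | z.1 = 0} {z | z.1 = 2 * ((L : ℤ) * n)}))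
    {m : ℕ} (h1 : L * n ≤ m) (h2 : 2 * m ≤ 3 * (L * n)) :
    ((1 - Real.sqrt (1 - x)) * x) ^ 2 /
        ((1 + (2 / min (p : ℝ) (1 - p)) ^ (3 * ((5 * k + 4) * (2 * (6 * ρ + 4) + 1) ^ 2))) ^ 2 *
          (1 + (2 / min (p : ℝ) (1 - p)) ^ (3 * ((5 * k + 4) * (2 * (2 * (3 * ρ + 3)) + 1) ^ 2)))) ≤
      (bondPercolation (slabGraph 3 k) p).real (slabConn k (boxR 0 (2 * m) 0 m) {z | z.1 = 0} {z | z.1 = 2 * m}) := by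
  set P := bondPercolation (slabGraph 3 k) p with hP
  set K : ℝ := (1 + (2 / min (p : ℝ) (1 - p)) ^ (3 * ((5 * k + 4) * (2 * (6 * ρ + 4) + 1) ^ 2))) ^ 2 *
      (1 + (2 / min (p : ℝ) (1 - p)) ^ (3 * ((5 * k + 4) * (2 * (2 * (3 * ρ + 3)) + 1) ^ 2))) with hK
  have hKpos : 0 < K := by positivity
  clear_value K
  have hstep := real_lr_3L_ge hk hρ hLn p hp0 hp1
  rw [← hK] at hstep
  have hmono : (bondPercolation (slabGraph 3 k) p).real
        (slabConn k (boxR 0 (3 * ((L : ℤ) * n)) 0 ((L : ℤ) * n)) {z | z.1 = 0} {z | z.1 = 3 * ((L : ℤ) * n)}) ≤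
      (bondPercolation (slabGraph 3 k) p).real (slabConn k (boxR 0 (2 * m) 0 m) {z | z.1 = 0} {z | z.1 = 2 * m}) := by
    have h1' : ((L * n : ℕ) : ℤ) ≤ m := by exact_mod_cast h1
    have h2' : (2 : ℤ) * m ≤ 3 * ((L * n : ℕ) : ℤ) := by exact_mod_cast h2
    push_cast at h1' h2'
    calc (bondPercolation (slabGraph 3 k) p).real
          (slabConn k (boxR 0 (3 * ((L : ℤ) * n)) 0 ((L : ℤ) * n)) {z | z.1 = 0} {z | z.1 = 3 * ((L : ℤ) * n)})
        ≤ (bondPercolation (slabGraph 3 k) p).real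
            (slabConn k (boxR 0 (2 * m) 0 ((L : ℤ) * n)) {z | z.1 = 0} {z | z.1 = 2 * m}) :=
          real_lr_wider_le (k := k) (a := 0) (b := 2 * m) (b' := 3 * ((L : ℤ) * n)) (c := 0) (d := (L : ℤ) * n)
            (by positivity) h2' p
      _ ≤ _ := real_lr_le_taller (k := k) (a := 0) (b := 2 * m) (c := 0) (d := (L : ℤ) * n) (c' := 0) (d' := m)
            le_rfl h1' p
  set f := P.real (slabConn k (boxR 0 (2 * ((L : ℤ) * n)) 0 ((L : ℤ) * n)) {z : ℤ × ℤ | z.1 = 0}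
    {z | z.1 = 2 * ((L : ℤ) * n)}) with hf
  have hf1 : f ≤ 1 := measureReal_le_one
  have hsq : 1 - Real.sqrt (1 - x) ≤ 1 - Real.sqrt (1 - f) := by
    have := Real.sqrt_le_sqrt (show 1 - f ≤ 1 - x by linarith)
    linarith
  have hs0 : 0 ≤ 1 - Real.sqrt (1 - x) := by
    have h1 : Real.sqrt (1 - x) ≤ Real.sqrt 1 := Real.sqrt_le_sqrt (by linarith)
    rw [Real.sqrt_one] at h1
    linarith
  have hprod : (1 - Real.sqrt (1 - x)) * x ≤ (1 - Real.sqrt (1 - f)) * f :=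
    mul_le_mul hsq hx hx0 (hs0.trans hsq)
  have hsq2 : ((1 - Real.sqrt (1 - x)) * x) ^ 2 ≤ ((1 - Real.sqrt (1 - f)) * f) ^ 2 :=
    pow_le_pow_left₀ (mul_nonneg hs0 hx0) hprod 2
  rw [div_le_iff₀ hKpos]
  calc ((1 - Real.sqrt (1 - x)) * x) ^ 2 ≤ ((1 - Real.sqrt (1 - f)) * f) ^ 2 := hsq2
    _ ≤ K * (bondPercolation (slabGraph 3 k) p).real
        (slabConn k (boxR 0 (3 * ((L : ℤ) * n)) 0 ((L : ℤ) * n)) {z | z.1 = 0} {z | z.1 = 3 * ((L : ℤ) * n)}) := hstep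
    _ ≤ K * P.real (slabConn k (boxR 0 (2 * m) 0 m) {z | z.1 = 0} {z | z.1 = 2 * m}) :=
        mul_le_mul_of_nonneg_left hmono hKpos.le
    _ = _ := by ring

/-- **NTW 2017, THEOREM 3.14 — ASSEMBLY FROM THE THREE CASES.**  Slab `S_k` (`k ≥ 1`), `ρ ≥ 4`,
`0 < p < 1`, `0 < c₀ ≤ 1`.  Assume (3.38): `c₀ ≤ f_p(m,2m)` for all `m ≥ 1`.  Let `𝓑₂ n` be ANY
events satisfying (H2) (`P[𝓑₂ n] ≥ x ⇒ P[𝓑₁ n] ≥ y(x)` eventually; in NTW: GL, Theorem 3.7) and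
(H3) (`P[𝒜 n ∩ (𝓑₁ n)ᶜ ∩ (𝓑₂ n)ᶜ] ≥ x ⇒ f(14n,13n) ≥ y(x)` eventually; in NTW: the exploration
step (3.47)–(3.49) with Lemma 3.16), where `𝓑₁ n = {Y ⟷^R X}` and `𝒜 n` is the event of Lemma 3.15.
Then `∃ c' > 0, ∀ m ≥ 1, c' ≤ f_p(2m, m)` — the conclusion `inf_m f(2m,m) > 0` of Theorem 3.14.
[cite: NewmanTassionWu2017, Theorem 3.14 (proof, (3.39)–(3.54))] -/
theorem thm314_of_cases (hk : 1 ≤ k) {ρ : ℕ} (hρ : 4 ≤ ρ) (p : unitInterval) (hp0 : 0 < (p : ℝ))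
    (hp1 : (p : ℝ) < 1) {c₀ : ℝ} (hc₀ : 0 < c₀) (hc₁ : c₀ ≤ 1)
    (h338 : ∀ m : ℕ, 1 ≤ m → c₀ ≤ (bondPercolation (slabGraph 3 k) p).real
      (slabConn k (boxR 0 m 0 (2 * m)) {z | z.1 = 0} {z | z.1 = m}))
    (B₂ : ℕ → Set (BondConfig (slab 3 k)))
    (hCase2 : ∀ x : ℝ, 0 < x → ∃ y : ℝ, 0 < y ∧ ∃ n₂ : ℕ, ∀ n : ℕ, n₂ ≤ n →
      x ≤ (bondPercolation (slabGraph 3 k) p).real (B₂ n) →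
      y ≤ (bondPercolation (slabGraph 3 k) p).real (slabConn k (boxR (-(7 * n)) (7 * n) 0 (13 * n - 1))
        (sideSeg (7 * n) (5 * n) (13 * n - 1)) (sideSeg (7 * n) 0 (4 * n - 1))))
    (hCase3 : ∀ x : ℝ, 0 < x → ∃ y : ℝ, 0 < y ∧ ∃ n₃ : ℕ, ∀ n : ℕ, n₃ ≤ n →
      x ≤ (bondPercolation (slabGraph 3 k) p).real
        ((slabConn k (boxR 0 (7 * n) 0 (8 * n - 1)) {z | z.1 = 0} (sideSeg (7 * n) 0 (4 * n - 1)) ∩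
            slabConn k (boxR (-(7 * n)) (7 * n) 0 (13 * n - 1)) {z | z.2 = 0} (sideSeg (7 * n) (5 * n) (13 * n - 1))) ∩
          (slabConn k (boxR (-(7 * n)) (7 * n) 0 (13 * n - 1)) (sideSeg (7 * n) (5 * n) (13 * n - 1))
            (sideSeg (7 * n) 0 (4 * n - 1)))ᶜ ∩ (B₂ n)ᶜ) →
      y ≤ (bondPercolation (slabGraph 3 k) p).real
        (slabConn k (boxR 0 (14 * n) 0 (13 * n)) {z | z.1 = 0} {z | z.1 = 14 * n})) :
    ∃ c' : ℝ, 0 < c' ∧ ∀ m : ℕ, 1 ≤ m → c' ≤ (bondPercolation (slabGraph 3 k) p).real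
      (slabConn k (boxR 0 (2 * m) 0 m) {z | z.1 = 0} {z | z.1 = 2 * m}) := by
  classical
  set P := bondPercolation (slabGraph 3 k) p with hP
  -- abbreviations for the events
  set B₁ : ℕ → Set (BondConfig (slab 3 k)) := fun n => slabConn k (boxR (-(7 * n)) (7 * n) 0 (13 * n - 1))
    (sideSeg (7 * n) (5 * n) (13 * n - 1)) (sideSeg (7 * n) 0 (4 * n - 1)) with hB₁
  set A : ℕ → Set (BondConfig (slab 3 k)) := fun n =>
    slabConn k (boxR 0 (7 * n) 0 (8 * n - 1)) {z | z.1 = 0} (sideSeg (7 * n) 0 (4 * n - 1)) ∩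
      slabConn k (boxR (-(7 * n)) (7 * n) 0 (13 * n - 1)) {z | z.2 = 0} (sideSeg (7 * n) (5 * n) (13 * n - 1)) with hA
  -- Lemma 3.15
  obtain ⟨c₄, hc₄, h315⟩ := lemma315 (k := k) hk (ρ := ρ) (by omega) p hp0 hp1 hc₀ hc₁
  set x : ℝ := c₄ / 3 with hx
  have hx0 : 0 < x := by positivity
  obtain ⟨y₂, hy₂, n₂, hC2⟩ := hCase2 x hx0
  obtain ⟨y₃, hy₃, n₃, hC3⟩ := hCase3 x hx0
  -- the linear-regime constants
  set Λ : ℝ := 1 + (2 / min (p : ℝ) (1 - p)) ^ (3 * ((5 * k + 4) * (2 * (2 * (3 * ρ + 3)) + 1) ^ 2)) with hΛ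
  have hΛpos : 0 < Λ := by positivity
  clear_value Λ
  set K : ℝ := (1 + (2 / min (p : ℝ) (1 - p)) ^ (3 * ((5 * k + 4) * (2 * (6 * ρ + 4) + 1) ^ 2))) ^ 2 *
      (1 + (2 / min (p : ℝ) (1 - p)) ^ (3 * ((5 * k + 4) * (2 * (2 * (3 * ρ + 3)) + 1) ^ 2))) with hK
  have hKpos : 0 < K := by positivity
  clear_value K
  let φ : ℝ → ℝ := fun t => ((1 - Real.sqrt (1 - t)) * t) ^ 2 / K
  have φpos : ∀ {t : ℝ}, 0 < t → t ≤ 1 → 0 < φ t := by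
    intro t ht ht1
    have hs1 : Real.sqrt (1 - t) < 1 := by
      have h1 : Real.sqrt (1 - t) < Real.sqrt 1 := Real.sqrt_lt_sqrt (by linarith) (by linarith)
      rwa [Real.sqrt_one] at h1
    have : 0 < 1 - Real.sqrt (1 - t) := by linarith
    positivity
  -- Case 1/2 constants (from `case1_of_B1`) and the Case 3 constant (from `real_lr_item1_iter`)
  set κ₁ : ℝ := x / 32 * (x / 32 / Λ) ^ 27 with hκ₁
  set y₂' : ℝ := min y₂ 1 with hy₂'
  have hy₂'0 : 0 < y₂' := lt_min hy₂ one_pos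
  set κ₂ : ℝ := y₂' / 32 * (y₂' / 32 / Λ) ^ 27 with hκ₂
  set y₃' : ℝ := min y₃ 1 with hy₃'
  have hy₃'0 : 0 < y₃' := lt_min hy₃ one_pos
  have hy₃'1 : y₃' ≤ 1 := min_le_right _ _
  obtain ⟨a, ha0, ha1, -, -, hiter⟩ := real_lr_item1_iter hk hρ p hp0 hp1 hy₃'0 hy₃'1
  have hκ₁0 : 0 < κ₁ := by positivity
  have hκ₂0 : 0 < κ₂ := by positivity
  -- bounds `≤ 1` for the arguments of `φ`
  have hκle : ∀ {c : ℝ}, 0 ≤ c → c ≤ 1 → c / 32 * (c / 32 / Λ) ^ 27 ≤ 1 := by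
    intro c hc0 hc1
    have hΛ1 : 1 ≤ Λ := by rw [hΛ]; exact le_add_of_nonneg_right (by positivity)
    have h1 : c / 32 / Λ ≤ 1 := by
      rw [div_le_one hΛpos]; linarith
    have h2 : (c / 32 / Λ) ^ 27 ≤ 1 := pow_le_one₀ (by positivity) h1
    have h3 : c / 32 ≤ 1 := by linarith
    calc c / 32 * (c / 32 / Λ) ^ 27 ≤ 1 * 1 := mul_le_mul h3 h2 (by positivity) zero_le_one
      _ = 1 := one_mul 1
  have hx1 : x ≤ 1 := by
    have : c₄ ≤ 1 := by
      have := h315 (ρ + 8) le_rfl h338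
      exact this.trans measureReal_le_one
    rw [hx]; linarith
  set cstar : ℝ := min (min (φ κ₁) (φ κ₂)) (φ (a 12)) with hcstar
  have hcstar0 : 0 < cstar :=
    lt_min (lt_min (φpos hκ₁0 (hκle hx0.le hx1)) (φpos hκ₂0 (hκle hy₂'0.le (min_le_right _ _)))) (φpos (ha0 12) (ha1 12))
  -- the scale threshold
  set N : ℕ := max (max (max (2 * ρ + 8) (8 * ρ + 17)) (max n₂ n₃)) 3 with hN
  -- MAIN STEP: for `n ≥ N` and `14n ≤ m ≤ 19n`, `cstar ≤ f(2m, m)`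
  have hmain : ∀ n : ℕ, N ≤ n → ∀ m : ℕ, 14 * n ≤ m → m ≤ 19 * n →
      cstar ≤ P.real (slabConn k (boxR 0 (2 * m) 0 m) {z | z.1 = 0} {z | z.1 = 2 * m}) := by
    intro n hn m hm1 hm2
    have hnρ8 : ρ + 8 ≤ n := by omega
    have hn2ρ : 2 * ρ + 4 ≤ n := by omega
    have hn₂ : n₂ ≤ n := by omega
    have hn₃ : n₃ ≤ n := by omega
    have h14 : 8 * ρ + 16 < 14 * n := by omega
    have h13 : 8 * ρ + 16 < 13 * n := by omega
    have hA' := h315 n hnρ8 h338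
    -- the union bound `c₄ ≤ P[𝓑₁] + P[𝓑₂] + P[𝒜 ∩ 𝓑₁ᶜ ∩ 𝓑₂ᶜ]`
    have hsplit : c₄ ≤ P.real (B₁ n) + P.real (B₂ n) + P.real (A n ∩ (B₁ n)ᶜ ∩ (B₂ n)ᶜ) := by
      have hsub : A n ⊆ B₁ n ∪ B₂ n ∪ (A n ∩ (B₁ n)ᶜ ∩ (B₂ n)ᶜ) := by
        intro ω hω
        by_cases h1 : ω ∈ B₁ n
        · exact Or.inl (Or.inl h1)
        by_cases h2 : ω ∈ B₂ n
        · exact Or.inl (Or.inr h2)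
        exact Or.inr ⟨⟨hω, h1⟩, h2⟩
      calc c₄ ≤ P.real (A n) := hA'
        _ ≤ P.real (B₁ n ∪ B₂ n ∪ (A n ∩ (B₁ n)ᶜ ∩ (B₂ n)ᶜ)) := measureReal_mono hsub (measure_ne_top _ _)
        _ ≤ P.real (B₁ n ∪ B₂ n) + P.real (A n ∩ (B₁ n)ᶜ ∩ (B₂ n)ᶜ) := measureReal_union_le _ _
        _ ≤ P.real (B₁ n) + P.real (B₂ n) + P.real (A n ∩ (B₁ n)ᶜ ∩ (B₂ n)ᶜ) := by
            linarith [measureReal_union_le (μ := P) (B₁ n) (B₂ n)]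
    -- Cases 1 and 2 both give `c ≤ P[𝓑₁ n]` for some `c ∈ {x, y₂'}`; then `case1_of_B1` and `L = 14`
    have case12 : ∀ {c : ℝ}, 0 < c → c ≤ 1 → c ≤ P.real (B₁ n) →
        φ (c / 32 * (c / 32 / Λ) ^ 27) ≤ P.real (slabConn k (boxR 0 (2 * m) 0 m) {z | z.1 = 0} {z | z.1 = 2 * m}) := by
      intro c hc0 hc1 hcB
      have h1 := case1_of_B1 hk hρ hn2ρ p hp0 hp1 hc0.le hcB
      rw [← hΛ] at h1
      have h1' : c / 32 * (c / 32 / Λ) ^ 27 ≤ P.real (slabConn k (boxR 0 (2 * ((14 : ℤ) * n)) 0 ((14 : ℤ) * n))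
          {z : ℤ × ℤ | z.1 = 0} {z | z.1 = 2 * ((14 : ℤ) * n)}) := by
        rw [show (2 : ℤ) * (14 * (n : ℤ)) = 28 * n by ring]; exact h1
      have h2 := real_lr_two_one_ge_of_f2L hk hρ p hp0 hp1 (L := 14) (n := n) h14
        (x := c / 32 * (c / 32 / Λ) ^ 27) (by positivity) (by push_cast; exact h1') (m := m) (by omega) (by omega)
      rw [← hK] at h2
      exact h2
    by_cases hb1 : x ≤ P.real (B₁ n)
    · exact ((min_le_left _ _).trans (min_le_left _ _)).trans (case12 hx0 hx1 hb1)
    by_cases hb2 : x ≤ P.real (B₂ n)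
    · have hyB : y₂' ≤ P.real (B₁ n) := (min_le_left _ _).trans (hC2 n hn₂ hb2)
      exact ((min_le_left _ _).trans (min_le_right _ _)).trans (case12 hy₂'0 (min_le_right _ _) hyB)
    · -- Case 3
      push Not at hb1 hb2
      have hb3 : x ≤ P.real (A n ∩ (B₁ n)ᶜ ∩ (B₂ n)ᶜ) := by rw [hx] at hb1 hb2 ⊢; linarith
      have hf14 : y₃' ≤ P.real (slabConn k (boxR 0 (14 * n) 0 (13 * n)) {z : ℤ × ℤ | z.1 = 0} {z | z.1 = 14 * n}) :=
        (min_le_left _ _).trans (hC3 n hn₃ hb3)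
      have h26 := hiter (13 * n) n h13 (by omega) 12 (by
        push_cast
        rw [show (13 : ℤ) * n + n = 14 * n by ring]
        exact hf14)
      have e : ((13 * n : ℕ) : ℤ) + (((12 : ℕ) : ℤ) + 1) * (n : ℤ) = 2 * ((13 : ℤ) * n) := by push_cast; ring
      rw [e] at h26
      push_cast at h26
      have h2 := real_lr_two_one_ge_of_f2L hk hρ p hp0 hp1 (L := 13) (n := n) h13 (ha0 12).le
        (by push_cast; exact h26) (m := m) (by omega) (by omega)
      rw [← hK] at h2
      exact (min_le_right _ _).trans h2
  -- the final constant
  refine ⟨min cstar ((p : ℝ) ^ (2 * (14 * N))), lt_min hcstar0 (by positivity), fun m hm => ?_⟩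
  by_cases hsmall : m < 14 * N
  · refine (min_le_right _ _).trans ?_
    have h1 := pow_le_real_lr (k := k) (2 * m) m p
    push_cast at h1
    exact (pow_le_pow_of_le_one p.2.1 p.2.2 (by omega)).trans h1
  · push Not at hsmall
    refine (min_le_left _ _).trans ?_
    set n := m / 14 with hn
    have hnm : 14 * n ≤ m := Nat.mul_div_le m 14
    have hm19 : m ≤ 19 * n := by omega
    have hNn : N ≤ n := by omega
    exact hmain n hNn m hnm hm19

end NTW17

end Literature.Probability.Percolation
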